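import Summits.HubbardSuperconductivity.HubbardSuperconductivity.Theorems.WidthHaldaneBridge.Negative.UniformThermoVoidRegion
import Summits.HubbardSuperconductivity.HubbardSuperconductivity.Theorems.WidthHaldaneTubeKinematics
import Summits.HubbardSuperconductivity.HubbardSuperconductivity.Theorems.JosephsonMirrorJmCuspFreeLayersNotSimple
import Literature.MathematicalPhysics.QuantumLattice.FreeFermionSectorGroundStates

/-!
# `WidthUniformThermodynamics` (stmt-HubbardSuperconductivity-16312), negative side:
# `0 < U` is load-bearing — at zero coupling the pair-compressibility floor `0 < ẽ″` fails on the
# square members of the family, at every doping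

The crux (`widthUniformThermodynamics_iff`, landed): `∃ U > 0, δ ∈ (0, 3/10), d₀ > 0, k₀, M₁, L₀,
UniformThermo U δ d₀ k₀ M₁ L₀`, where `UniformThermo` demands, for all even `L ≥ L₀`, all even widths
`M₁ ≤ M ≤ L` and every labelling, (i) `d₀ ≤ ρ̃_{L,M}` and (ii)–(iii) `0 < ẽ″_{L,M} ≤ k₀` with
`ẽ″_{L,M} = LM[E(N+2) + E(N−2) − 2E(N)]/4` (`tubePairCompressibility`), `E(N)` the untwisted
`(N, S^z = 0)` sector minimum and `N = N_{L,M}(δ) = 2⌊(1−δ)LM/2⌋`.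

This file proves, sorry-free, that the interaction is LOAD-BEARING for clause (ii): with `U := 0` the
matrix `UniformThermo` is false for EVERY `δ ∈ (0, 1)` and all data, because on the square members
`M = L` (which the width-uniform family contains) the free pair compressibility vanishes for
infinitely many even `L`:

* `minEnergyOn_szSector_free_eq_of_shell` — inside a shell of the free band of the `L × L` torus the
  `(2j, S^z = 0)` floor is AFFINE in `j`: `E₀(2j) = 2(Σ_{ε<μ} ε + (j − #{ε<μ})·μ)` for
  `#{ε < μ} ≤ j ≤ #{ε ≤ μ}` (the paired Fermi sea over `{ε<μ}` plus any `j − #{ε<μ}` shell momenta is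
  optimal, `minEnergyOn_szSector_free_eq`);
* `free_secondDifference_eq_zero_of_openShell` — hence on an OPEN shell (`#{ε<μ} < m < #{ε≤μ}`) the
  second difference `E₀(2m+2) + E₀(2m−2) − 2E₀(2m)` is `0`;
* `tubePairCompressibility_diag_zero_coupling_eq_zero` — for even `L ≥ 4` and shell number
  `n_L = ⌊(1−δ)L²/2⌋ ≢ 1 (mod 4)` (`1 ≤ n_L`, `2n_L < L²`) the crux's functional on the square tube at
  `U = 0` is `ẽ″_{L,L}(0, δ) = 0` (the shell of `n_L` is open: `openShell_of_mod_four_ne_one` — closed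
  shells strictly below the van Hove level hold `≡ 1 (mod 4)` momenta, those at or above it more than
  `L²/2 > n_L`);
* `exists_admissible_square_tubePairCompressibility_eq_zero` — at every `δ ∈ (0,1)` such `L` exist
  beyond every threshold (`n_L ≢ 1 (mod 4)` for some `L ∈ {2m, 4m, 6m, 8m}`,
  `exists_even_ge_floor_mod_four_ne_one`), so an ADMISSIBLE member `(L, M) = (L, L)`, `L ≥ max(L₀, M₁)`
  even, has `ẽ″ = 0`;
* `uniformThermo_zero_coupling_false`, `widthUniformThermodynamics_false_at_zero_coupling` — hence
  `UniformThermo 0 δ d₀ k₀ M₁ L₀` is false for all `δ ∈ (0,1)`, `d₀, k₀, M₁, L₀`, and the crux with its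
  leading `∃ U, 0 < U ∧ …` replaced by `U := 0` is FALSE on the whole window `δ ∈ (0, 3/10)`.

Reading for provers/planners: the compressibility floor `0 < ẽ″_{L,M}` of clause (ii) is an
INTERACTION effect on the open-shell lengths of the diagonal — at those `L` it tends to `0` with `U`
(first-order degenerate perturbation theory inside the shell), so no bound of the form
"`ẽ″ ≥ c > 0` uniformly in `U ∈ [0, U₀]`" exists, and any proof of the crux at a point `(U, δ)` must
split the free shell degeneracy of the `L × L` torus for all but finitely many even `L`. (The twin
statement for the stiffness clause (i) at `U = 0`, and the fixed-width version of this file, would need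
the free floor of the RECTANGULAR / TWISTED tube, which the tree does not have; see
`Cruxes/PerWidthThermodynamics/Disproof.lean` §(a').) The crux itself (`0 < U`) is untouched.

Sources: J. Bardeen, L. N. Cooper, J. R. Schrieffer, Phys. Rev. 108 (1957) 1175 §II (Fermi seas);
D. J. Scalapino, Phys. Rep. 250 (1995) 329 §2 (shell structure of the square-lattice band);
D. J. Scalapino, S. R. White, S. C. Zhang, PRB 47 (1993) 7995 §II (the compressibility / charge-gap
criterion). Folklore finite-dimensional statements; no definitions, no named facts.
-/

noncomputable section

namespace Summit.HubbardSuperconductivity.HubbardSuperconductivity.Theorems.WidthUniformThermodynamics.Negative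

set_option linter.dupNamespace false -- summit = problem name (single-conjunct summit), D-0017

open scoped BigOperators Classical Matrix ComplexConjugate
open Matrix Finset Literature.MathematicalPhysics.QuantumLattice Literature.Probability.LatticeModels
open Summit.HubbardSuperconductivity.HubbardSuperconductivity.Theorems.WidthHaldane
open Summit.HubbardSuperconductivity.HubbardSuperconductivity.Theorems.WidthHaldaneBridge.Negative
open Summit.HubbardSuperconductivity.HubbardSuperconductivity.Theorems.JosephsonMirror
open Summit.HubbardSuperconductivity.HubbardSuperconductivity.Theses.WidthHaldane
  (WidthUniformThermodynamics)

variable {L : ℕ} [NeZero L]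

/-! ### The free floor is affine in the pair number across a shell -/

/-- **Free sector floor inside a shell.** For `L ≥ 3`, a level `μ` and a pair number `j` with
`#{ε_L < μ} ≤ j ≤ #{ε_L ≤ μ}`, the floor of the free torus `hubbardTorus 2 L 1 0` on
`szSector (2j) 0` is `2(Σ_{ε_L(k) < μ} ε_L(k) + (j − #{ε_L < μ})·μ)`: fill `{ε_L < μ}` and any
`j − #{ε_L < μ}` momenta of the shell `{ε_L = μ}`; this is a Fermi set with level `μ`, so
`minEnergyOn_szSector_free_eq` applies. Bardeen–Cooper–Schrieffer (1957) §II. [folklore] -/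
theorem minEnergyOn_szSector_free_eq_of_shell (hL : 3 ≤ L) (μ : ℝ) {j : ℕ}
    (hB : (univ.filter fun k : TorusSite 2 L => torusBand L k < μ).card ≤ j)
    (hA : j ≤ (univ.filter fun k : TorusSite 2 L => torusBand L k ≤ μ).card) :
    (hubbardTorus 2 L 1 0).minEnergyOn (szSector (Λ := FermionTorus 2 L) (2 * j) 0) =
      2 * (∑ k ∈ univ.filter (fun k : TorusSite 2 L => torusBand L k < μ), torusBand L k +
        ((j : ℝ) - ((univ.filter fun k : TorusSite 2 L => torusBand L k < μ).card : ℝ)) * μ) := by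
  set B : Finset (TorusSite 2 L) := univ.filter fun k : TorusSite 2 L => torusBand L k < μ with hBdef
  set A : Finset (TorusSite 2 L) := univ.filter fun k : TorusSite 2 L => torusBand L k ≤ μ with hAdef
  have hBA : B ⊆ A := fun k hk => by
    rw [hBdef, mem_filter] at hk
    rw [hAdef, mem_filter]
    exact ⟨hk.1, hk.2.le⟩
  have hShc : (A \ B).card = A.card - B.card := card_sdiff_of_subset hBA
  obtain ⟨T, hT, hTc⟩ := exists_subset_card_eq (s := A \ B) (n := j - B.card) (by omega)
  have hTμ : ∀ k ∈ T, torusBand L k = μ := fun k hk => by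
    have hk' := hT hk
    rw [mem_sdiff, hAdef, hBdef, mem_filter, mem_filter] at hk'
    push Not at hk'
    exact le_antisymm hk'.1.2 (hk'.2 (mem_univ _))
  have hdisj : Disjoint B T := by
    rw [Finset.disjoint_left]
    intro k hkB hkT
    exact (mem_sdiff.1 (hT hkT)).2 hkB
  have hBj : B.card ≤ j := hB
  have hFc : (B ∪ T).card = j := by
    rw [card_union_of_disjoint hdisj, hTc]; omega
  have hF : ∀ k ∈ B ∪ T, torusBand L k ≤ μ := fun k hk => by
    rcases mem_union.1 hk with h | h
    · exact (mem_filter.1 h).2.le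
    · exact (hTμ k h).le
  have hF' : ∀ k ∉ B ∪ T, μ ≤ torusBand L k := fun k hk => by
    by_contra h
    exact hk (mem_union_left _ (mem_filter.2 ⟨mem_univ _, not_le.mp h⟩))
  have key := minEnergyOn_szSector_free_eq hL (B ∪ T) μ hF hF'
  rw [hFc] at key
  rw [key, sum_union hdisj, sum_congr rfl hTμ, sum_const, nsmul_eq_mul, hTc, Nat.cast_sub hBj]

/-- **On an open shell the free floor has vanishing second difference in the pair number**: for
`L ≥ 3` and `#{ε_L < μ} < m < #{ε_L ≤ μ}`,
`E₀(2m+2) + E₀(2m−2) − 2E₀(2m) = 0` (`E₀(2j)` the floor of `hubbardTorus 2 L 1 0` on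
`szSector (2j) 0`; all three pair numbers lie in the shell, where `E₀` is affine). [folklore] -/
theorem free_secondDifference_eq_zero_of_openShell (hL : 3 ≤ L) (μ : ℝ) {m : ℕ}
    (hlt : (univ.filter fun k : TorusSite 2 L => torusBand L k < μ).card < m)
    (hgt : m < (univ.filter fun k : TorusSite 2 L => torusBand L k ≤ μ).card) :
    (hubbardTorus 2 L 1 0).minEnergyOn (szSector (Λ := FermionTorus 2 L) (2 * (m + 1)) 0) +
        (hubbardTorus 2 L 1 0).minEnergyOn (szSector (Λ := FermionTorus 2 L) (2 * (m - 1)) 0) -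
      2 * (hubbardTorus 2 L 1 0).minEnergyOn (szSector (Λ := FermionTorus 2 L) (2 * m) 0) = 0 := by
  have hm : 1 ≤ m := by omega
  rw [minEnergyOn_szSector_free_eq_of_shell hL μ (j := m + 1) (by omega) (by omega),
    minEnergyOn_szSector_free_eq_of_shell hL μ (j := m - 1) (by omega) (by omega),
    minEnergyOn_szSector_free_eq_of_shell hL μ (j := m) (by omega) (by omega)]
  push_cast [Nat.cast_sub hm]
  ring

/-! ### The crux's compressibility functional at `U = 0` on the square tube -/

/-- **At zero coupling the inverse pair compressibility of the square tube vanishes on open shells.**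
For even `L ≥ 4`, the coordinate labelling `e` of `FermionTorus 2 L`, and a doping `δ` whose shell
number `n_L = ⌊(1−δ)L²/2⌋` satisfies `1 ≤ n_L`, `2n_L < L²`, `n_L ≢ 1 (mod 4)`:
`ẽ″_{L,L}(U = 0, δ) = tubePairCompressibility L L (FermionTorus 2 L) e 0 δ = 0`. The shell of `n_L`
is open (`openShell_of_mod_four_ne_one`), the tube Hamiltonian at zero twist is `hubbardTorus 2 L 1 0`
(`tubeEnergy_zero`, `tubeH0_diag_eq_hubbardTorus`), and the free floor is affine across the shell.
[folklore] -/
theorem tubePairCompressibility_diag_zero_coupling_eq_zero (hLe : Even L) (h4 : 4 ≤ L) (δ : ℝ)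
    (e : FermionTorus 2 L ≃ ZMod L × ZMod L)
    (he : ∀ x, e x = (FermionTorus.toTorusSite x 0, FermionTorus.toTorusSite x 1))
    (hn1 : 1 ≤ ⌊(1 - δ) * (L : ℝ) ^ 2 / 2⌋₊) (hnL : 2 * ⌊(1 - δ) * (L : ℝ) ^ 2 / 2⌋₊ < L ^ 2)
    (hmod : ⌊(1 - δ) * (L : ℝ) ^ 2 / 2⌋₊ % 4 ≠ 1) :
    tubePairCompressibility L L (FermionTorus 2 L) e 0 δ = 0 := by
  rw [tubePairCompressibility_eq, tubeEnergy_zero, tubeEnergy_zero, tubeEnergy_zero,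
    tubeH0_diag_eq_hubbardTorus 0 e he, tubeFilling_diag]
  set n : ℕ := ⌊(1 - δ) * (L : ℝ) ^ 2 / 2⌋₊ with hn
  have e1 : 2 * n + 2 = 2 * (n + 1) := by ring
  have e2 : 2 * n - 2 = 2 * (n - 1) := by omega
  rw [e1, e2]
  obtain ⟨hlt, hgt⟩ := openShell_of_mod_four_ne_one hLe hn1 hnL hmod
  have h := free_secondDifference_eq_zero_of_openShell (L := L) (by omega)
    (torusFermiLevel L (2 * n)) hlt hgt
  rw [h, mul_zero, zero_div]

/-- **At every doping an admissible square member of the family has vanishing free pair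
compressibility.** For `0 < δ < 1` and all thresholds `M₁, L₀` there is an even `L ≥ max(L₀, M₁)`
(so `(L, M) = (L, L)` is admissible in `UniformThermo … M₁ L₀`) and a labelling `e` of the square
carrier `FermionTorus 2 L` with `ẽ″_{L,L}(0, δ) = 0`: take `L ∈ {2m, 4m, 6m, 8m}` with
`n_L ≢ 1 (mod 4)` (`exists_even_ge_floor_mod_four_ne_one`). [folklore] -/
theorem exists_admissible_square_tubePairCompressibility_eq_zero {δ : ℝ} (hδ0 : 0 < δ) (hδ1 : δ < 1)
    (M₁ L₀ : ℕ) :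
    ∃ L : ℕ, ∃ _ : NeZero L, Even L ∧ L₀ ≤ L ∧ M₁ ≤ L ∧
      ∃ e : FermionTorus 2 L ≃ ZMod L × ZMod L,
        (∀ x, e x = (FermionTorus.toTorusSite x 0, FermionTorus.toTorusSite x 1)) ∧
          tubePairCompressibility L L (FermionTorus 2 L) e 0 δ = 0 := by
  have hx : 0 < 1 - δ := by linarith
  obtain ⟨L, hLe, hLge, hL4, hmod⟩ :=
    exists_even_ge_floor_mod_four_ne_one hx.le (max (max L₀ M₁) ⌈2 / (1 - δ)⌉₊)
  haveI : NeZero L := ⟨by omega⟩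
  have hL0 : L₀ ≤ L := le_trans (le_trans (le_max_left _ _) (le_max_left _ _)) hLge
  have hM1 : M₁ ≤ L := le_trans (le_trans (le_max_right _ _) (le_max_left _ _)) hLge
  have hLc : ⌈2 / (1 - δ)⌉₊ ≤ L := le_trans (le_max_right _ _) hLge
  set n : ℕ := ⌊(1 - δ) * (L : ℝ) ^ 2 / 2⌋₊ with hn
  have hLr : (2 / (1 - δ) : ℝ) ≤ L := le_trans (Nat.le_ceil _) (by exact_mod_cast hLc)
  have hL1 : (1 : ℝ) ≤ L := by exact_mod_cast (show 1 ≤ L by omega)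
  have hn1 : 1 ≤ n := by
    refine Nat.le_floor ?_
    rw [Nat.cast_one]
    have h2 : 2 ≤ (1 - δ) * L := by
      rw [div_le_iff₀ hx] at hLr; linarith
    have : (1 - δ) * L ≤ (1 - δ) * (L : ℝ) ^ 2 := by
      rw [sq]; exact mul_le_mul_of_nonneg_left (le_mul_of_one_le_left (by positivity) hL1) hx.le
    linarith
  have hnL : 2 * n < L ^ 2 := by
    have h1 : (n : ℝ) ≤ (1 - δ) * (L : ℝ) ^ 2 / 2 := Nat.floor_le (by positivity)
    have h2 : (1 - δ) * (L : ℝ) ^ 2 / 2 < (L : ℝ) ^ 2 / 2 := by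
      rw [div_lt_div_iff_of_pos_right two_pos]
      have hL2 : (0 : ℝ) < (L : ℝ) ^ 2 := by positivity
      nlinarith
    have h3 : (2 * n : ℝ) < (L : ℝ) ^ 2 := by linarith
    exact_mod_cast h3
  obtain ⟨e, he, -⟩ := exists_diagLabel L
  exact ⟨L, inferInstance, hLe, hL0, hM1, e, he,
    tubePairCompressibility_diag_zero_coupling_eq_zero hLe hL4 δ e he hn1 hnL hmod⟩

/-! ### `0 < U` is load-bearing -/

/-- **`UniformThermo` fails at zero coupling, at every doping and for all data.** For `0 < δ < 1`
and every `d₀, k₀, M₁, L₀`: `¬ UniformThermo 0 δ d₀ k₀ M₁ L₀` — clause (ii) `0 < ẽ″_{L,M}` is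
violated (with equality `ẽ″ = 0`) on an admissible square member `M = L`. [folklore] -/
theorem uniformThermo_zero_coupling_false {δ : ℝ} (hδ0 : 0 < δ) (hδ1 : δ < 1) (d₀ k₀ : ℝ)
    (M₁ L₀ : ℕ) : ¬ UniformThermo 0 δ d₀ k₀ M₁ L₀ := by
  intro h
  obtain ⟨L, _, hLe, hL0, hM1, e, -, h0⟩ :=
    exists_admissible_square_tubePairCompressibility_eq_zero hδ0 hδ1 M₁ L₀
  obtain ⟨-, hpos, -⟩ := h L L hLe hLe hM1 le_rfl hL0 (FermionTorus 2 L) e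
  rw [h0] at hpos
  exact lt_irrefl _ hpos

/-- **`0 < U` is load-bearing in `WidthUniformThermodynamics` (stmt-HubbardSuperconductivity-16312).**
The crux with its leading `∃ U : ℝ, 0 < U ∧ …` replaced by the free value `U := 0` — i.e.
`∃ δ ∈ (0, 3/10), d₀ > 0, k₀, M₁, L₀, UniformThermo 0 δ d₀ k₀ M₁ L₀`, the matrix read through
`widthUniformThermodynamics_iff` — is FALSE: free fermions violate the compressibility floor on the
square members of the width-uniform family at every doping of the window. Consequently the
interaction must enter any proof of the crux non-perturbatively in `L` (the free violation is an
exact shell degeneracy recurring along all `L ∈ {2m, 4m, 6m, 8m}`-type subsequences). [folklore] -/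
theorem widthUniformThermodynamics_false_at_zero_coupling :
    ¬ ∃ δ ∈ Set.Ioo (0 : ℝ) (3 / 10), ∃ d₀ : ℝ, 0 < d₀ ∧ ∃ k₀ : ℝ, ∃ M₁ L₀ : ℕ,
        UniformThermo 0 δ d₀ k₀ M₁ L₀ := by
  rintro ⟨δ, hδ, d₀, -, k₀, M₁, L₀, h⟩
  exact uniformThermo_zero_coupling_false hδ.1 (by linarith [hδ.2]) d₀ k₀ M₁ L₀ h

/-- **Calibration of the crux along the coupling axis** (reading lemma): every witness
`(U, δ, d₀, k₀, M₁, L₀)` of the matrix `UniformThermo` on the doping window has `U ≠ 0`; the crux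
asks for one with `0 < U`. [folklore] -/
theorem uniformThermo_coupling_ne_zero {U δ d₀ k₀ : ℝ} {M₁ L₀ : ℕ} (hδ : δ ∈ Set.Ioo (0 : ℝ) 1)
    (h : UniformThermo U δ d₀ k₀ M₁ L₀) : U ≠ 0 := by
  rintro rfl
  exact uniformThermo_zero_coupling_false hδ.1 hδ.2 d₀ k₀ M₁ L₀ h

end Summit.HubbardSuperconductivity.HubbardSuperconductivity.Theorems.WidthUniformThermodynamics.Negative

end
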